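import Summits.BirchSwinnertonDyer.BirchSwinnertonDyer.Theorems.PrintX10bUpperLinkRoad
import Summits.BirchSwinnertonDyer.BirchSwinnertonDyer.Theorems.PrintX10bBeyondCarrierUpperLinkOfPrint
import Summits.BirchSwinnertonDyer.BirchSwinnertonDyer.Theorems.PrintX9HeegnerDivisibility
import Summits.BirchSwinnertonDyer.BirchSwinnertonDyer.Theorems.KolyvaginRoadThreeTowerFormPrintFree
import Literature.NumberTheory.EllipticCurves.BSDSelmerCMPConverseHeegnerFieldProofs
import Summits.BirchSwinnertonDyer.BirchSwinnertonDyer.Theses.PrintX10b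
import HarnessLib

/-!
# Line `cha-sandwich-mu-x10b` — crux dir `HowardContainmentAnyClassNumberX10b` (items 23729 → live re-types
27274 `HowardContainmentLightFrameX10bPinned` / 27487 `MuPartSharpX10b`), route PrintX10b rev 38.

Seat bsd-idea-5 g7 (D-0145 ideator, lens «transfer»; technique, not persona). PUBLISH-ONLY (W-79): not
registered, no `skeleton check`. BSD is not proved by any of this; no crux is closed by this file.

## The lever (layer 0, class-number-free)

On a light X10b frame (`p = 3` good ordinary, `E[3]` irreducible, `ρ̄_{E,3}` not onto, non-CM; `K` imaginary
quadratic, `d_K` odd `≠ −3`, Heegner for `N_E` and `3`; (irr_K); anticyclotomic `(ι, κ, γ)`; Manin-good `Dt`;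
`P = y_K` of infinite order) — ANY class number `h_K` — three PRINTED facts at the trivial character sandwich
the constant term of `F = char(X_Gr)` (the Greenberg/BDP Selmer dual at the induced place):

* JSW 2017 Thm 3.3.1 (`thm331_anticyclotomicControl`, typed, in `HeegnerPrintFactsX10b`):
  `ord₃ F(0) = ord₃ #Ш(E/K)[3^∞] + 2·(e − 1 + ord₃ log_ω P − ord₃[E(K):ℤP]) + ord₃ ∏_w c_w(E/K)`,
  `e := ord₃(1 − a₃ + 3)`, and `∏_w c_w(E/K) = (∏_ℓ c_ℓ(E))²` (all bad primes split);
* Cha 2005 Thm 21 = the `t = 0` instance of `Cha2005.rmk25_…` (typed, in `HeegnerPrintFactsX10b`; at `t = 0`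
  it is the NUMBERED theorem [Cha2005 p. 173], whose §5.2.1 (Prop. 26, Ex. 27: 245A1) is written FOR
  `ρ̄_{E,3}` irreducible non-surjective): `ord₃ #Ш(E/K) ≤ 2·ord₃[E(K):ℤy_K]` — NO `3 ∤ h_K`, no surjectivity;
* CGLS 2022 Thm 5.1.3 ∘ BCS 2025 Prop 4.2.2 ∘ YZ 2026 Thm 5.7 (1) (route door facts): `ord₃ L^{BDP}(𝟙) =
  2·(e − 1 + ord₃ log_ω y_K)`, `μ(L^{BDP}) = 0`, `(F) = (L^{BDP})` in `Λ^{ur} ⊗ ℚ`.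

Consequences (elementary; `Λ^{ur}` a UFD with `3` prime): `F = 3^{μ(X_Gr)}·L^{BDP}·unit`, hence the DICTIONARY

  `μ(X_Gr(E/K_∞)) = ord₃ #Ш(E/K) + 2·ord₃ ∏_ℓ c_ℓ(E) − 2·ord₃ [E(K):ℤ y_K]`  (= the 3-adic BSD defect of E/K)
  `0 ≤ μ(X_Gr) ≤ 2·(ord₃ ∏_ℓ c_ℓ(E) − t)`  for every global divisibility depth `t` of the derived Heegner points.

So on CARRIER-FREE curves (`3 ∤ ∏_ℓ c_ℓ(E)`) the one-sided link U₃ — and with it `μ(X_Gr) = 0`, the integral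
equality `(F)Λ^{ur} = (L^{BDP})`, and (YZ 5.9 (1)⇒(2) at `s = 1`, pinned, any `h_K`) Howard's containment
`I(ℋ_F)² ⊆ char(𝔛_tors)` — are PRINT at every class number: §1 below is the kernel-checked U₃ half
(`upperLinkLightX10bOn_carrierFree_of_heegnerPrintFacts`, NO sorry, from `HeegnerPrintFactsX10b` alone).
What remains of U₃ ∕ the μ-crux at `3 ∣ h_K` is EXACTLY the carrier curves (§2 `stub_upperLink_carrier…`), i.e.
token-for-token the J₃ Σ-regime residual of crux 23055 (the two route residuals are one statement in two
currencies: twins ⇒ J₃ is the cell's `BeyondCarrierAllFramesOfTwins`; J₃ + Cha-at-depth ⇒ U₃ ⇒ μ = 0 ⇒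
containment is this line). §3 composes to the leaf through the route's own `bsdpOnClassX10b_of_upperLink_of_printFacts`.
§4 types the transfer back to the crux currency (containment from U₃ at a frame) as a stub. §5 (rev 2,
NO sorry) gives the B-side twin for free: on carrier-free light frames carrying a non-torsion `y_K` the
TWO-SIDED identity `X11b.IMCWaldspurgerOnTreeGoodAt` (the conclusion of crux 26622 / 23730
`TwoSidedLinkAnyClassNumberX10b[Pinned]`) holds from `HeegnerPrintFactsX10b` ALONE at any `h_K` — §1 (upper) +
the cell's lower link `X11b.imcLowerWaldspurgerOnTreeGoodAt_inducedPlace_of_thm57_of_thm331` (YZ 5.7 (1) ∘ BCS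
4.2.2 ∘ CGLS 5.1.3 + JSW) + `XAc.HasCharValuationAt.unique`; the GRANTED containment of 26622 is not used.

Transfer lens, recorded: the crux's μ-question is moved from the Λ-adic tower (where `3 ∣ h_K` obstructs
Howard/Mastella–Zerman and non-surjectivity obstructs integrality) to LAYER 0 over `K`, where Kolyvagin–Cha is
class-number-free and image-light; the Euler characteristic at `𝟙` carries it back up. The same dictionary
upgrades the g3 line `congruent-partner-mu-x10b`: a congruent partner `E'` (`E'[3] ≅ E[3]`) now certifies
`μ = 0` as soon as it is carrier-free with `y'_K` non-torsion — anomalous or not, `3 ∣ [E'(K):ℤy'_K]` or not,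
`Ш(E'/K)[3] ≠ 0` or not (g3's flagged anomalous residue disappears); see the card.
-/

set_option autoImplicit false
set_option linter.dupNamespace false

noncomputable section

open scoped Classical MatrixGroups ModularForm

open CongruenceSubgroup WeierstrassCurve NumberField IsDedekindDomain
  Literature.NumberTheory.EllipticCurves Literature.NumberTheory.EllipticCurves.ModularForms
  Literature.NumberTheory.EllipticCurves.JetchevSkinnerWan2017
  Literature.NumberTheory.EllipticCurves.YanZhu2026
  Summit.BirchSwinnertonDyer.BirchSwinnertonDyer.Theorems.Rank1ResidualX1Defs
  Summit.BirchSwinnertonDyer.Rank1Residual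
  Summit.BirchSwinnertonDyer.Rank1Residual.X11b.Three.Koly
  Summit.BirchSwinnertonDyer.Rank1Residual.X11b.KolyvaginBottom
  Summit.BirchSwinnertonDyer.BirchSwinnertonDyer.Rank1Residual
  Summit.BirchSwinnertonDyer.BirchSwinnertonDyer.Theses.PrintX10b

open Literature.NumberTheory.EllipticCurves.Rank1Residual (ClassX10 Surj Irr Good GoodOrd)

namespace Summit.BirchSwinnertonDyer.BirchSwinnertonDyer.Cruxes.HowardContainmentAnyClassNumberX10b.ChaSandwichMuX10b

/-! ### §0 The one-sided link U₃ on the light X10b frames, cut by a side condition -/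

/-- **U₃ on the light frames satisfying a side condition `S W p K`.** The body is, letter for letter, the
`hU3` binder of the route's leaf theorem `X10.bsdpOnClassX10b_of_upperLink_of_printFacts`
(`Theorems/PrintX10bUpperLinkRoad.lean`), with `S W p K →` inserted after the field binders. -/
def UpperLinkLightX10bOn
    (S : ∀ (W : WeierstrassCurve ℚ) (p : ℕ) (K : Type) [Field K] [NumberField K], Prop) : Prop :=
  ∀ (W : WeierstrassCurve ℚ) [W.IsElliptic] [W.IsGloballyMinimal] (p : ℕ) [Fact p.Prime]
    [NeZero (W.conductorNorm ℤ)] (K : Type) [Field K] [NumberField K],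
    S W p K →
    ClassX10 W p → ¬ Surj W 3 → ¬ W.HasCM → IsImaginaryQuadratic K → Odd (NumberField.discr K) →
    NumberField.discr K ≠ -3 → SatisfiesHeegnerHypothesis (W.conductorNorm ℤ) K →
    SatisfiesHeegnerHypothesis p K → (W.baseChange K).HasIrreducibleModPGaloisRep p →
    ∀ (ι : K →+* ℚ_[p]) (κ : ZpExtension K p), κ.IsAnticyclotomic →
    ∀ (γ : Field.absoluteGaloisGroup K) [Fact (κ.IsTopGenerator γ)]
      (Dt : ModularParametrizationData W (W.conductorNorm ℤ)), ¬ (p : ℤ) ∣ Dt.c →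
    ∀ (H : HeegnerDatum (W.conductorNorm ℤ) (NumberField.discr K)) (ιC : K →+* ℂ)
      (P : (W.baseChange K).toAffine.Point),
      WeierstrassCurve.Affine.Point.map ιC.toRatAlgHom P = heegnerPointComplex Dt H →
      (W.baseChange K).mordellWeilRank = 1 →
      Finite (AddCommGroup.primaryComponent (W.baseChange K).sha p) → ¬ IsOfFinAddOrder P →
    ∃ n : ℕ, X11b.AcSelmer.XAc.HasCharValuationAt (W.baseChange K) p κ (X11b.inducedPlace ι) ∅ γ n ∧
      (n : ℤ) ≤ 2 * (X11b.padicLogOrd W p ι P + (padicValInt p (1 - W.frobeniusTrace p + p) : ℤ) - 1)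

/-- **U₃ on all light frames** = the route's `hU3` (no side condition). -/
def UpperLinkLightX10b : Prop :=
  ∀ (W : WeierstrassCurve ℚ) [W.IsElliptic] [W.IsGloballyMinimal] (p : ℕ) [Fact p.Prime]
    [NeZero (W.conductorNorm ℤ)] (K : Type) [Field K] [NumberField K],
    ClassX10 W p → ¬ Surj W 3 → ¬ W.HasCM → IsImaginaryQuadratic K → Odd (NumberField.discr K) →
    NumberField.discr K ≠ -3 → SatisfiesHeegnerHypothesis (W.conductorNorm ℤ) K →
    SatisfiesHeegnerHypothesis p K → (W.baseChange K).HasIrreducibleModPGaloisRep p →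
    ∀ (ι : K →+* ℚ_[p]) (κ : ZpExtension K p), κ.IsAnticyclotomic →
    ∀ (γ : Field.absoluteGaloisGroup K) [Fact (κ.IsTopGenerator γ)]
      (Dt : ModularParametrizationData W (W.conductorNorm ℤ)), ¬ (p : ℤ) ∣ Dt.c →
    ∀ (H : HeegnerDatum (W.conductorNorm ℤ) (NumberField.discr K)) (ιC : K →+* ℂ)
      (P : (W.baseChange K).toAffine.Point),
      WeierstrassCurve.Affine.Point.map ιC.toRatAlgHom P = heegnerPointComplex Dt H →
      (W.baseChange K).mordellWeilRank = 1 →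
      Finite (AddCommGroup.primaryComponent (W.baseChange K).sha p) → ¬ IsOfFinAddOrder P →
    ∃ n : ℕ, X11b.AcSelmer.XAc.HasCharValuationAt (W.baseChange K) p κ (X11b.inducedPlace ι) ∅ γ n ∧
      (n : ℤ) ≤ 2 * (X11b.padicLogOrd W p ι P + (padicValInt p (1 - W.frobeniusTrace p + p) : ℤ) - 1)

/-- Glue (logic only): two side conditions covering every frame give U₃ on all light frames. -/
theorem upperLinkLightX10b_of_cover
    {S₁ S₂ : ∀ (W : WeierstrassCurve ℚ) (p : ℕ) (K : Type) [Field K] [NumberField K], Prop}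
    (h₁ : UpperLinkLightX10bOn S₁) (h₂ : UpperLinkLightX10bOn S₂)
    (hcov : ∀ (W : WeierstrassCurve ℚ) (p : ℕ) (K : Type) [Field K] [NumberField K],
      S₁ W p K ∨ S₂ W p K) :
    UpperLinkLightX10b := by
  intro W _ _ p _ _ K _ _ hX hns hcm hK hodd h3 hHN hHp hirrK ι κ hκ γ _ Dt hc H ιC P hP hrk hfin hPinf
  rcases hcov W p K with h | h
  · exact h₁ W p K h hX hns hcm hK hodd h3 hHN hHp hirrK ι κ hκ γ Dt hc H ιC P hP hrk hfin hPinf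
  · exact h₂ W p K h hX hns hcm hK hodd h3 hHN hHp hirrK ι κ hκ γ Dt hc H ιC P hP hrk hfin hPinf

/-- Glue (logic only): three side conditions covering every frame. -/
theorem upperLinkLightX10b_of_cover₃
    {S₁ S₂ S₃ : ∀ (W : WeierstrassCurve ℚ) (p : ℕ) (K : Type) [Field K] [NumberField K], Prop}
    (h₁ : UpperLinkLightX10bOn S₁) (h₂ : UpperLinkLightX10bOn S₂) (h₃ : UpperLinkLightX10bOn S₃)
    (hcov : ∀ (W : WeierstrassCurve ℚ) (p : ℕ) (K : Type) [Field K] [NumberField K],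
      S₁ W p K ∨ S₂ W p K ∨ S₃ W p K) :
    UpperLinkLightX10b := by
  intro W _ _ p _ _ K _ _ hX hns hcm hK hodd h3 hHN hHp hirrK ι κ hκ γ _ Dt hc H ιC P hP hrk hfin hPinf
  rcases hcov W p K with h | h | h
  · exact h₁ W p K h hX hns hcm hK hodd h3 hHN hHp hirrK ι κ hκ γ Dt hc H ιC P hP hrk hfin hPinf
  · exact h₂ W p K h hX hns hcm hK hodd h3 hHN hHp hirrK ι κ hκ γ Dt hc H ιC P hP hrk hfin hPinf
  · exact h₃ W p K h hX hns hcm hK hodd h3 hHN hHp hirrK ι κ hκ γ Dt hc H ιC P hP hrk hfin hPinf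

/-! ### §1 KERNEL THEOREM (no sorry): U₃ on CARRIER-FREE light frames, ANY class number, from print

The Cha sandwich at depth `t = 0`: Cha 2005 Thm 21 (`hChaU` at `t = 0`, via the cell's adapter
`X9.shaIndexBound_sharp_of_globalDivisibility`) gives `ord₃ #Ш(E/K) ≤ 2·ord₃[E(K):ℤy_K]`; JSW 3.3.1 (the cell's
`X11b.controlOnTreeGoodAt_of_thm331_of_inducedPlace`) and the all-split Tamagawa comparison (the cell's
`upperLink_iff_shaTamagawa_le_of_control_of_allSplit`) turn U₃ at the frame into
`ord₃ #Ш(E/K) + 2·ord₃ ∏_ℓ c_ℓ(E) ≤ 2·ord₃[E(K):ℤy_K]`; with `3 ∤ ∏_ℓ c_ℓ(E)` the two coincide. No `3 ∤ h_K`,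
no Howard, no Kolyvagin SYSTEM, no Λ-adic object beyond JSW's typed control statement. -/

/-- **U₃ on the carrier-free light X10b frames (`3 ∤ ∏_ℓ c_ℓ(E)`), every class number, from
`HeegnerPrintFactsX10b` alone.** [cite: Cha2005, Thm. 21 (p. 173), Main Thm. 2 (p. 155), §5.2.1 (pp. 176–177)]
[cite: JetchevSkinnerWan2017, Thm. 3.3.1] [cite: GrossLMS1991, §3] -/
theorem upperLinkLightX10bOn_carrierFree_of_heegnerPrintFacts (hHP : HeegnerPrintFactsX10b) :
    UpperLinkLightX10bOn (fun W p _K ↦ ¬ p ∣ W.tamagawaProduct) := by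
  obtain ⟨-, hKo, hrec, -, hChaU, -, -, h331, -⟩ := hHP
  intro W _ _ p _ _ K _ _ htam hX hns hcm hK hodd h3 hHN hHp hirrK ι κ hκ γ _ Dt hc H ιC P hP hrk hfinp
    hPinf
  obtain ⟨hp3, hord, hirr, -⟩ := id hX
  subst hp3
  have hpP : (3 : ℕ).Prime := Fact.out
  have hp2 : (3 : ℕ) ≠ 2 := by norm_num
  have h4 : NumberField.discr K ≠ -4 := by
    rintro h
    rw [h] at hodd
    exact absurd hodd (by decide)
  -- Kolyvagin: `Ш(E/K)` is finite (the Heegner point `P = y_K` has infinite order)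
  obtain ⟨-, hshaK⟩ := hKo (W.conductorNorm ℤ) W K hK hHN ⟨Dt, H, ιC, hP⟩ hPinf
  haveI : Finite (W.baseChange K).sha := hshaK
  -- JSW 2017 Thm. 3.3.1: the control link at the induced place
  have hCTL : X11b.ControlOnTreeGoodAt 3 κ (X11b.inducedPlace ι) γ ι P :=
    X11b.controlOnTreeGoodAt_of_thm331_of_inducedPlace h331 le_rfl hord.1 hK hHp rfl hHN hirrK ι κ hκ γ
      hrk hfinp P hPinf
  rw [Cruxes.BeyondCarrierDepthX10b.UpperHalf.upperLink_iff_shaTamagawa_le_of_control_of_allSplit hK rfl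
    hHN hCTL]
  -- a conductor-1 Kolyvagin datum on the frame (Gross §3, print-free); its derived point is `y_K = P`
  obtain ⟨d₁⟩ := Theorems.nonempty_kolyvaginHeegnerData_one_printFree W K Dt H.β ιC hK hHN H.dvd_sq_sub
  have hPd : d₁.toGeomPoints d₁.derivedPoint = toGeomPoints (W.baseChange K) P :=
    toGeomPoints_derivedPoint_one_eq (hrec _ W K) hK hHN hP d₁ rfl
  -- `E(K)[3] = 0` from irreducibility
  have hbot := torsionBy_eq_bot_of_isImaginaryQuadratic_of_hasIrreducibleModPGaloisRep W K hK hpP hirr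
  have hiv : ∀ x : (W.baseChange K).toAffine.Point, 3 • x = 0 → x = 0 := fun x hx ↦ by
    have hmem : x ∈ AddSubgroup.torsionBy (W.baseChange K).toAffine.Point ((3 : ℕ) : ℤ) :=
      AddSubgroup.torsionBy.nsmul_iff.mpr hx
    rw [hbot] at hmem
    exact hmem
  -- Cha 2005 Thm. 21 = depth `t = 0` of the structure bound under irreducibility
  have hCha := X9.shaIndexBound_sharp_of_globalDivisibility hChaU W K 3 hp2 hcm hord.1 hirr hK h3 h4 hHN
    hHp Dt H.β ιC d₁ P hPd hPinf hrk hiv (t := 0)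
    (fun s hs n d _ _ ↦ by
      obtain rfl : s = 0 := Nat.le_zero.mp hs
      exact ⟨d.derivedPoint, by rw [pow_zero, Nat.cast_one, one_zsmul]⟩)
  -- no carrier: the Tamagawa slack vanishes
  have htam0 : padicValNat 3 W.tamagawaProduct = 0 := padicValNat.eq_zero_of_not_dvd htam
  rw [WeierstrassCurve.shaOrder, htam0]
  omega

/-! ### §2 STUBS — what is left of U₃ (≡ the μ-crux ≡ the J₃ Σ-regime) -/

/-- **RESIDUAL STUB (the line's single beyond-print statement).** U₃ on the light frames of CARRIER curves
(`3 ∣ ∏_ℓ c_ℓ(E)`) over fields with `3 ∣ h_K`. By the dictionary of the module docstring this is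
`μ(X_Gr(E/K_∞)) = 0` there, equivalently `M_∞ = ord₃ ∏_ℓ c_ℓ(E)` (global divisibility of the derived Heegner
points to full Tamagawa depth = crux 23055's Σ-regime on `3 ∣ h_K` frames), equivalently BSD₃(E/K). On
`3 ∤ h_K` frames the same statement is PRINT (`stub_upperLink_carrier_coprimeClassNumber`). Why it might fail:
it does not fail as a statement short of BSD being false on X10b; what may fail is every KNOWN mechanism —
no printed source gives `M_∞ ≥ t` beyond one carrier's depth at `p = 3` (Jetchev Thm 1.4 = one prime), and
the Λ-adic road needs integrality at non-surjective image. [cite: Jetchev2008, Thm. 1.4]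
[cite: BurungaleEtAl2026, Thm. 2 (p > 3, (sur))] [cite: Cha2005, Rmk. 25] -/
theorem stub_upperLink_carrier_divisibleClassNumber :
    UpperLinkLightX10bOn (fun W p K ↦ p ∣ W.tamagawaProduct ∧ p ∣ NumberField.classNumber K) := by
  sorry

/-- **PRINT STUB (not this line's content; packaging only).** U₃ on carrier frames with `3 ∤ h_K` — the cell's
`Cruxes.BeyondCarrierDepthX10b.UpperHalf.upperLinkX10b_coprimeClassNumber_of_namedFacts` /
`…_of_pinnedPrintFacts` (Mastella–Zerman Cor. 4.6 at `3` ∘ the YZ/BCS/CGLS composite ∘ JSW 3.3.1), modulo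
destructuring the route's fact bundles into its seven binders. [cite: MastellaZerman2026, Cor. 4.6]
[cite: YanZhu2024MainConjNonCM, Thm. 5.7 (1), Thm. 5.9] [cite: JetchevSkinnerWan2017, Thm. 3.3.1] -/
theorem stub_upperLink_carrier_coprimeClassNumber (h46 : MastellaZermanHowardDivisibility)
    (hT : PinnedTransferPrintFacts) (hHP : HeegnerPrintFactsX10b) :
    UpperLinkLightX10bOn (fun W p K ↦ p ∣ W.tamagawaProduct ∧ ¬ p ∣ NumberField.classNumber K) := by
  sorry

/-! ### §3 COMPOSITIONS (no sorry outside the stubs) -/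

/-- **U₃ on every light frame** from §1 (print, kernel) and the two §2 stubs. -/
theorem upperLinkLightX10b_of_stubs
    (hres : UpperLinkLightX10bOn (fun W p K ↦ p ∣ W.tamagawaProduct ∧ p ∣ NumberField.classNumber K))
    (hcop : UpperLinkLightX10bOn (fun W p K ↦ p ∣ W.tamagawaProduct ∧ ¬ p ∣ NumberField.classNumber K))
    (hHP : HeegnerPrintFactsX10b) : UpperLinkLightX10b :=
  upperLinkLightX10b_of_cover₃ (upperLinkLightX10bOn_carrierFree_of_heegnerPrintFacts hHP) hres hcop
    (fun W p K _ _ ↦ by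
      by_cases ht : p ∣ W.tamagawaProduct
      · by_cases hh : p ∣ NumberField.classNumber K
        · exact Or.inr (Or.inl ⟨ht, hh⟩)
        · exact Or.inr (Or.inr ⟨ht, hh⟩)
      · exact Or.inl ht)

/-- **THE DOOR TO THE LEAF.** `X10.BSDpOnClassX10b` (BSD at `3` for every non-CM X10b pair — the statement the
route's assemblies `AssemblyLightTwinsX10b` / `AssemblyPinnedTwinsX10b` / `AssemblyHeegner` conclude) from:
the ONE residual stub (carrier curves, `3 ∣ h_K`), the print stub (carrier curves, `3 ∤ h_K`), and the
route's fact items `HeegnerPrintFactsX10b`, `AnalyticMuZeroX10b`, `PrintFactsX10b` — through the route's own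
leaf theorem `X10.bsdpOnClassX10b_of_upperLink_of_printFacts` (p608951). The Howard-side cruxes 27274/27487
and the B-side 26622 are BYPASSED on carrier-free curves: nothing Λ-adic is needed there at any `h_K`.
CONDITIONAL on the two stubs; proves no crux; BSD is not proved by this. -/
theorem bsdpOnClassX10b_of_chaSandwich
    (hres : UpperLinkLightX10bOn (fun W p K ↦ p ∣ W.tamagawaProduct ∧ p ∣ NumberField.classNumber K))
    (hcop : UpperLinkLightX10bOn (fun W p K ↦ p ∣ W.tamagawaProduct ∧ ¬ p ∣ NumberField.classNumber K))
    (hA : AnalyticMuZeroX10b) (hHP : HeegnerPrintFactsX10b) (hP : PrintFactsX10b) :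
    Summit.BirchSwinnertonDyer.Rank1Residual.X10.BSDpOnClassX10b :=
  Summit.BirchSwinnertonDyer.Rank1Residual.X10.bsdpOnClassX10b_of_upperLink_of_printFacts
    (upperLinkLightX10b_of_stubs hres hcop hHP) hA hHP hP

/-- **The same door with the stubs discharged by name** (sorries live only inside the two `stub_*`). -/
theorem bsdpOnClassX10b_of_chaSandwich_of_stubs (h46 : MastellaZermanHowardDivisibility)
    (hT : PinnedTransferPrintFacts) (hA : AnalyticMuZeroX10b) (hHP : HeegnerPrintFactsX10b)
    (hP : PrintFactsX10b) : Summit.BirchSwinnertonDyer.Rank1Residual.X10.BSDpOnClassX10b :=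
  bsdpOnClassX10b_of_chaSandwich stub_upperLink_carrier_divisibleClassNumber
    (stub_upperLink_carrier_coprimeClassNumber h46 hT hHP) hA hHP hP

/-! ### §4 TRANSFER BACK TO THE CRUX CURRENCY (typed stub): containment from U₃ at one frame

`U₃ at a frame with y_K non-torsion` ⇒ (with the lower link, free from YZ 5.7 (1) ∘ BCS 4.2.2 ∘ CGLS 5.1.3)
`ord₃ F(0) = ord₃ L^{BDP}(𝟙)` ⇒ (UFD step: `F ∣ 3^k L`, `L ∣ 3^{k'} F`, `μ(L) = 0` in `Λ^{ur}` ⇒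
`F = 3^{μ_F}·L·u`) `μ_F = 0` and `(F)Λ^{ur} = (L^{BDP})` ⇒ (YZ 5.9 (1)⇒(2) at `s = 1`, pinned, any `h_K`:
`thm59_localised_pinned_anyClassNumber`, flag `YZ59-anyhK`) Howard's containment for every pinned family on
`Dt`. Stated as ONE stub in the binder shape of 27274 plus the two binders `P`, `¬ IsOfFinAddOrder P` the
sandwich needs (27274 itself has no `P`; on a rank-one frame with `y_K` torsion this line is silent). -/

/-- **STUB (transfer back; L-sized port, print modulo flag `YZ59-anyhK`).** On a light frame carrying a
non-torsion Heegner point, U₃ at the frame implies Howard's containment for some pinned family on `Dt`.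
[cite: YanZhu2024MainConjNonCM, Thm. 5.7 (1), Thm. 5.9] [cite: BurungaleCastellaSkinner2025, Prop. 4.2.2]
[cite: CastellaGrossiLeeSkinner2022, Thm. 5.1.3] -/
theorem stub_containment_of_upperLinkAt (hT : PinnedTransferPrintFacts) (hHP : HeegnerPrintFactsX10b) :
    ∀ (W : WeierstrassCurve ℚ) [W.IsElliptic] [W.IsGloballyMinimal] (p : ℕ) [Fact p.Prime]
    [NeZero (W.conductorNorm ℤ)] (K : Type) [Field K] [NumberField K],
    ClassX10 W p → ¬ Surj W 3 → ¬ W.HasCM → IsImaginaryQuadratic K → Odd (NumberField.discr K) →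
    NumberField.discr K ≠ -3 → SatisfiesHeegnerHypothesis (W.conductorNorm ℤ) K →
    SatisfiesHeegnerHypothesis p K → (W.baseChange K).HasIrreducibleModPGaloisRep p →
    ∀ (κ : ZpExtension K p), κ.IsAnticyclotomic → ∀ (γ : Field.absoluteGaloisGroup K), κ.IsTopGenerator γ →
    ∀ (Dt : ModularParametrizationData W (W.conductorNorm ℤ))
      (H : HeegnerDatum (W.conductorNorm ℤ) (NumberField.discr K)) (ιC : K →+* ℂ)
      (P : (W.baseChange K).toAffine.Point),
      WeierstrassCurve.Affine.Point.map ιC.toRatAlgHom P = heegnerPointComplex Dt H →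
      ¬ IsOfFinAddOrder P → ¬ (p : ℤ) ∣ Dt.c →
      (W.baseChange K).mordellWeilRank = 1 →
      Finite (AddCommGroup.primaryComponent (W.baseChange K).sha p) →
      -- U₃ at THIS frame, for every embedding and every generator instance
      (∀ (ι : K →+* ℚ_[p]) [Fact (κ.IsTopGenerator γ)],
        ∃ n : ℕ, X11b.AcSelmer.XAc.HasCharValuationAt (W.baseChange K) p κ (X11b.inducedPlace ι) ∅ γ n ∧
          (n : ℤ) ≤ 2 * (X11b.padicLogOrd W p ι P + (padicValInt p (1 - W.frobeniusTrace p + p) : ℤ) - 1)) →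
    ∃ (jbar : AlgebraicClosure K →+* ℂ) (D : (W.baseChange K).LambdaAdicSelmerData κ γ)
      (F : HeegnerFamily (W.conductorNorm ℤ) W K κ jbar) (X : (W.baseChange K).SelmerDualData κ γ),
      F.Dt = Dt ∧
      heegnerCharIdeal D F ^ 2 ≤
        Module.charIdeal (IwasawaAlgebra p) (Submodule.torsion (IwasawaAlgebra p) X.X) := by
  sorry

/-- **Howard's containment on the CARRIER-FREE light frames carrying a non-torsion Heegner point, ANY class
number** — 27274's conclusion there — from §1 (print, kernel) and the §4 transfer stub. CONDITIONAL on the stub. -/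
theorem howardContainment_carrierFree_of_transferStub
    (hT : PinnedTransferPrintFacts) (hHP : HeegnerPrintFactsX10b)
    (W : WeierstrassCurve ℚ) [W.IsElliptic] [W.IsGloballyMinimal] (p : ℕ) [Fact p.Prime]
    [NeZero (W.conductorNorm ℤ)] (K : Type) [Field K] [NumberField K]
    (htam : ¬ p ∣ W.tamagawaProduct)
    (hX : ClassX10 W p) (hns : ¬ Surj W 3) (hcm : ¬ W.HasCM) (hK : IsImaginaryQuadratic K)
    (hodd : Odd (NumberField.discr K)) (h3 : NumberField.discr K ≠ -3)
    (hHN : SatisfiesHeegnerHypothesis (W.conductorNorm ℤ) K) (hHp : SatisfiesHeegnerHypothesis p K)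
    (hirrK : (W.baseChange K).HasIrreducibleModPGaloisRep p)
    (κ : ZpExtension K p) (hκ : κ.IsAnticyclotomic) (γ : Field.absoluteGaloisGroup K)
    (hγ : κ.IsTopGenerator γ) (Dt : ModularParametrizationData W (W.conductorNorm ℤ))
    (H : HeegnerDatum (W.conductorNorm ℤ) (NumberField.discr K)) (ιC : K →+* ℂ)
    (P : (W.baseChange K).toAffine.Point)
    (hP : WeierstrassCurve.Affine.Point.map ιC.toRatAlgHom P = heegnerPointComplex Dt H)
    (hPinf : ¬ IsOfFinAddOrder P) (hc : ¬ (p : ℤ) ∣ Dt.c) (hrk : (W.baseChange K).mordellWeilRank = 1)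
    (hfin : Finite (AddCommGroup.primaryComponent (W.baseChange K).sha p)) :
    ∃ (jbar : AlgebraicClosure K →+* ℂ) (D : (W.baseChange K).LambdaAdicSelmerData κ γ)
      (F : HeegnerFamily (W.conductorNorm ℤ) W K κ jbar) (X : (W.baseChange K).SelmerDualData κ γ),
      F.Dt = Dt ∧
      heegnerCharIdeal D F ^ 2 ≤
        Module.charIdeal (IwasawaAlgebra p) (Submodule.torsion (IwasawaAlgebra p) X.X) :=
  stub_containment_of_upperLinkAt hT hHP W p K hX hns hcm hK hodd h3 hHN hHp hirrK κ hκ γ hγ Dt H ιC P hP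
    hPinf hc hrk hfin
    (fun ι _ ↦ upperLinkLightX10bOn_carrierFree_of_heegnerPrintFacts hHP W p K htam hX hns hcm hK hodd h3
      hHN hHp hirrK ι κ hκ γ Dt hc H ιC P hP hrk hfin hPinf)

/-! ### §5 THE B-SIDE TWIN FOR FREE (no sorry): the two-sided link on carrier-free light frames, any class number

Serves crux 23730 / 26622 (`TwoSidedLinkAnyClassNumberX10b[Pinned]`, whose conclusion at a frame is
`X11b.IMCWaldspurgerOnTreeGoodAt p κ (inducedPlace ι) γ ι P`). Upper half = §1 (Cha sandwich at `t = 0`);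
lower half = the cell's print theorem (YZ 5.7 (1) ∘ BCS 4.2.2 ∘ CGLS 5.1.3, generator from JSW 3.3.1; any
`h_K`, (irr_K) only); the two witnesses are identified by `XAc.HasCharValuationAt.unique`. The granted
containment binder of 26622 is NOT used: on carrier-free frames the B-side needs no Howard input at all. -/

/-- **Two-sided anticyclotomic link on the CARRIER-FREE light X10b frames carrying a non-torsion Heegner
point, ANY class number, from `HeegnerPrintFactsX10b` alone.** [cite: Cha2005, Thm. 21]
[cite: JetchevSkinnerWan2017, Thm. 3.3.1] [cite: YanZhu2024MainConjNonCM, Thm. 5.7 (1)]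
[cite: BurungaleCastellaSkinner2025, Prop. 4.2.2] [cite: CastellaGrossiLeeSkinner2022, Thm. 5.1.3] -/
theorem twoSidedLink_carrierFree_of_heegnerPrintFacts (hHP : HeegnerPrintFactsX10b)
    (W : WeierstrassCurve ℚ) [W.IsElliptic] [W.IsGloballyMinimal] (p : ℕ) [Fact p.Prime]
    [NeZero (W.conductorNorm ℤ)] (K : Type) [Field K] [NumberField K]
    (htam : ¬ p ∣ W.tamagawaProduct)
    (hX : ClassX10 W p) (hns : ¬ Surj W 3) (hcm : ¬ W.HasCM) (hK : IsImaginaryQuadratic K)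
    (hodd : Odd (NumberField.discr K)) (h3 : NumberField.discr K ≠ -3)
    (hHN : SatisfiesHeegnerHypothesis (W.conductorNorm ℤ) K) (hHp : SatisfiesHeegnerHypothesis p K)
    (hirrK : (W.baseChange K).HasIrreducibleModPGaloisRep p)
    (ι : K →+* ℚ_[p]) (κ : ZpExtension K p) (hκ : κ.IsAnticyclotomic) (γ : Field.absoluteGaloisGroup K)
    [Fact (κ.IsTopGenerator γ)] (Dt : ModularParametrizationData W (W.conductorNorm ℤ))
    (hc : ¬ (p : ℤ) ∣ Dt.c) (H : HeegnerDatum (W.conductorNorm ℤ) (NumberField.discr K)) (ιC : K →+* ℂ)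
    (P : (W.baseChange K).toAffine.Point)
    (hP : WeierstrassCurve.Affine.Point.map ιC.toRatAlgHom P = heegnerPointComplex Dt H)
    (hrk : (W.baseChange K).mordellWeilRank = 1)
    (hfin : Finite (AddCommGroup.primaryComponent (W.baseChange K).sha p)) (hPinf : ¬ IsOfFinAddOrder P) :
    X11b.IMCWaldspurgerOnTreeGoodAt p κ (X11b.inducedPlace ι) γ ι P := by
  obtain ⟨-, -, -, -, -, -, h57, h331, -⟩ := id hHP
  obtain ⟨hp3, hord, -, -⟩ := id hX
  subst hp3
  -- upper half: §1
  obtain ⟨n, hn, hle⟩ := upperLinkLightX10bOn_carrierFree_of_heegnerPrintFacts hHP W 3 K htam hX hns hcm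
    hK hodd h3 hHN hHp hirrK ι κ hκ γ Dt hc H ιC P hP hrk hfin hPinf
  -- lower half: the cell's print theorem (any class number)
  obtain ⟨m, hm, hge⟩ := X11b.imcLowerWaldspurgerOnTreeGoodAt_inducedPlace_of_thm57_of_thm331 h57 h331
    le_rfl hord hK hodd h3 rfl hHN hHp hirrK ι κ hκ γ Dt hc H ιC P hP hrk hfin hPinf
  have hmn : m = n := X11b.AcSelmer.XAc.HasCharValuationAt.unique hm hn
  subst hmn
  exact ⟨m, hm, le_antisymm hle hge⟩

end Summit.BirchSwinnertonDyer.BirchSwinnertonDyer.Cruxes.HowardContainmentAnyClassNumberX10b.ChaSandwichMuX10b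

end
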